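import Literature.AlgebraicGeometry.Resolution.AlterationsFormalCoordinates
import Literature.AlgebraicGeometry.Resolution.PowerSeriesRegularLocal
import Mathlib.RingTheory.AdicCompletion.LocalRing
import Mathlib.RingTheory.Derivation.Basic
import HarnessLib

/-!
# Stub `stub_completionDerivationParam` for crux stmt-ResolutionOfSingularities-15917
(`RadicialJung.CleanModels`)

The derivation `∂/∂t_{i₀}` on the `𝔪`-adic completion `Ô` of a regular local ring `O` of prime
characteristic `p`, adapted to a regular system of parameters `t : Fin d → O` (`(t) = 𝔪`,
`d = dim O`): a `ℤ`-derivation `D` of `Ô` with `D(t_{i₀}) = 1` and `D(t_i) = 0` for `i ≠ i₀`.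

Proof: `O` contains the prime field `𝔽_p` (image of `ZMod p`), so Cohen's structure theorem in
the sharp form of the tree (`exists_ringEquiv_adicCompletion_mvPowerSeries_of_rsop`,
`AlterationsFormalCoordinates.lean`: a regular system of parameters becomes the system of
variables) gives `e : Ô ≃+* κ⟦X_1, …, X_d⟧` with `e(t_i) = X_i`; transport the partial
derivative `∂/∂X_{i₀}` (`MvPowerSeries.pderiv`, `PowerSeriesRegularLocal.lean`) along `e` and
evaluate with `MvPowerSeries.pderiv_X` (`∂X_j/∂X_i = δ_{ij}`).
-/

noncomputable section

set_option linter.dupNamespace false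

open IsLocalRing Literature.AlgebraicGeometry.Resolution

namespace Summit.ResolutionOfSingularities.ResolutionOfSingularities.Theorems.RadicialJung.CleanModels

universe u

/-- **Transport of a derivation along a ring isomorphism.** For a derivation `D` of a commutative
ring `A` and a ring isomorphism `e : A ≃+* B` there is a `ℤ`-derivation `D'` of `B` (for any
`ℤ`-algebra structure on `B`) with `D' b = e (D (e⁻¹ b))`. -/
theorem exists_derivation_ringEquiv_transport {R A B : Type*} [CommRing R] [CommRing A]
    [CommRing B] [Algebra R A] [Algebra ℤ B] (D : Derivation R A A) (e : A ≃+* B) :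
    ∃ D' : Derivation ℤ B B, ∀ b, D' b = e (D (e.symm b)) := by
  refine ⟨{ toFun := fun b => e (D (e.symm b))
            map_add' := fun a b => by simp only [map_add]
            map_smul' := fun n b => by
              -- the given `ℤ`-algebra structure on `B` acts through `Int.cast`
              rw [RingHom.id_apply, Algebra.smul_def, eq_intCast, map_mul, map_intCast,
                Derivation.leibniz, Derivation.map_intCast, smul_zero, add_zero, smul_eq_mul,
                map_mul, map_intCast, zsmul_eq_mul]
            map_one_eq_zero' := by
              change e (D (e.symm 1)) = 0
              rw [map_one, Derivation.map_one_eq_zero, map_zero]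
            leibniz' := fun a b => by
              change e (D (e.symm (a * b))) = a • e (D (e.symm b)) + b • e (D (e.symm a))
              simp only [map_mul, Derivation.leibniz, map_add, smul_eq_mul,
                RingEquiv.apply_symm_apply] }, fun b => rfl⟩

/-- **The derivation `∂/∂t_{i₀}` on the completion.** For a regular local ring `O` of prime
characteristic `p` with regular system of parameters `t : Fin d → O` (`(t) = 𝔪`, `d = dim O`)
and an index `i₀`, the `𝔪`-adic completion `Ô` carries a derivation `D` with `D(t_{i₀}) = 1`
and `D(t_i) = 0` for `i ≠ i₀` (Cohen: `Ô ≅ κ⟦X_1, …, X_d⟧` with `X_i ↦ t_i` for a coefficient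
field `κ`; transport `∂/∂X_{i₀}`). -/
theorem stub_completionDerivationParam {O : Type u} [CommRing O] [IsRegularLocalRing O] (p : ℕ)
    [Fact p.Prime] [CharP O p] {d : ℕ} (t : Fin d → O)
    (ht : Ideal.span (Set.range t) = maximalIdeal O) (hd : ringKrullDim O = d) (i₀ : Fin d) :
    ∃ D : Derivation ℤ (AdicCompletion (maximalIdeal O) O) (AdicCompletion (maximalIdeal O) O),
      D (algebraMap O (AdicCompletion (maximalIdeal O) O) (t i₀)) = 1 ∧
      ∀ i, i ≠ i₀ → D (algebraMap O (AdicCompletion (maximalIdeal O) O) (t i)) = 0 := by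
  -- the prime field `𝔽_p` inside `O`
  let φ : ZMod p →+* O := ZMod.castHom (dvd_refl p) O
  have hφ : Function.Injective φ := φ.injective
  let k₀ : Subring O := φ.range
  have hk₀ : IsField k₀ :=
    MulEquiv.isField (Field.toIsField (ZMod p)) (RingEquiv.ofBijective φ.rangeRestrict
      ⟨fun a b h => hφ (congrArg Subtype.val h), φ.rangeRestrict_surjective⟩).symm.toMulEquiv
  -- Cohen coordinates `e : Ô ≃ κ⟦X⟧` with `e (t i) = X i`
  obtain ⟨e, he⟩ := exists_ringEquiv_adicCompletion_mvPowerSeries_of_rsop O k₀ hk₀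
    (RingEquiv.refl (ResidueField O)) t ht hd
  -- transport `∂/∂X_{i₀}` along `e`
  obtain ⟨D, hD⟩ := exists_derivation_ringEquiv_transport (MvPowerSeries.pderiv i₀) e.symm
  refine ⟨D, ?_, fun i hi => ?_⟩
  · rw [hD, RingEquiv.symm_symm, he, MvPowerSeries.pderiv_X, if_pos rfl, map_one]
  · rw [hD, RingEquiv.symm_symm, he, MvPowerSeries.pderiv_X, if_neg hi, map_zero]

end Summit.ResolutionOfSingularities.ResolutionOfSingularities.Theorems.RadicialJung.CleanModels

end
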